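import Literature.Topology.FourManifolds.MappingTorus
import Literature.Topology.FourManifolds.MappingTorusGlue
import Literature.Topology.FourManifolds.CircleSurgery
import Literature.Topology.FourManifolds.DehnSurgery
import Literature.Topology.FourManifolds.Knots
import HarnessLib

/-!
# drefute probes of the v2 definition `FibresWithVia` (line monodromy-kernel-engine, crux 0366)

`puncture` and `FibresWithVia` are copied VERBATIM from the v2 skeleton
`Cruxes/ZseCruxRasmussen/Lines/monodromy-kernel-engine.lean` (2026-08-16T02:58Z) into this scratch namespace,
so that consequences of the clause set can be kernel-checked without importing a Lines file.

Probe 1 (`FibresWithVia.phi_eq_self_on_collar`): the clauses are CONSISTENT in the way the planner claims —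
the standard-open-book clause pins `jA (y, 1/4)` and `jB (y, 5/4)` to the same point `ν (u, r • e^{iπ/2})`
(periodicity of `circlePoint`), so the gluing iff forces `θ y = y`, i.e. the capped monodromy `φ` is the
IDENTITY on the punctured collar `d (r • u)`, `0 < r < 1` (and `φ p = p`, planner's `apply_puncture`). Had the
angle conventions of the two cylinders been misaligned, this probe would instead have produced `False` from
any instance (vacuity); they are aligned.
-/

noncomputable section

set_option linter.dupNamespace false
set_option linter.unusedVariables false

open scoped Manifold ContDiff Topology
open Set Function
open Literature.Topology.FourManifolds

namespace Summit.SmoothPoincare4.SmoothPoincare4.Cruxes.ZseCruxRasmussen.MonodromyKernelEngine.Drefute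

/-- Local notation: `𝔼 n = ℝⁿ`. -/
local notation "𝔼 " n:arg => EuclideanSpace ℝ (Fin n)

/-- Local notation: `𝕊 n`, the unit sphere in `ℝⁿ⁺¹`. -/
local notation "𝕊 " n:arg => (Metric.sphere (0 : EuclideanSpace ℝ (Fin (n + 1))) 1)

/-- VERBATIM COPY of the skeleton's `puncture`. -/
def puncture (F : Type*) [TopologicalSpace F] [T1Space F] (p : F) : TopologicalSpace.Opens F :=
  ⟨{p}ᶜ, isOpen_compl_singleton⟩

/-- VERBATIM COPY of the skeleton's `FibresWithVia` (v2, 2026-08-16T02:58Z). -/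
def FibresWithVia (K : Knot) (ν : Knot.TubularNbhd K) (F : Type) [TopologicalSpace F] [T2Space F]
    [ChartedSpace (𝔼 2) F] (p : F) (φ : F ≃ₘ⟮𝓡 2, 𝓡 2⟯ F) : Prop :=
  ∃ (θ : ↥(puncture F p) ≃ₘ⟮𝓡 2, 𝓡 2⟯ ↥(puncture F p))
    (jA : ↥(puncture F p) × ↥mappingTorusPieceOne → ↥K.complement)
    (jB : ↥(puncture F p) × ↥mappingTorusPieceTwo → ↥K.complement)
    (d : (𝔼 2) → F),
    (∀ y : ↥(puncture F p), ((θ y : ↥(puncture F p)) : F) = φ (y : F)) ∧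
    IsOpenGluingWith ((𝓡 2).prod 𝓘(ℝ, ℝ)) ((𝓡 2).prod 𝓘(ℝ, ℝ)) (𝓡 3)
      (mappingTorusRel ⇑θ) jA jB ∧
    Manifold.IsSmoothEmbedding (𝓡 2) (𝓡 2) ∞ d ∧ IsOpen (range d) ∧ d 0 = p ∧
    (∀ (y : ↥(puncture F p)) (u : 𝕊 1) (r : ℝ), r ∈ Ioo (0 : ℝ) 1 →
      (y : F) = d (r • ((u : 𝕊 1) : 𝔼 2)) →
        (∀ s : ↥mappingTorusPieceOne,
          ((jA (y, s) : ↥K.complement) : 𝕊 3) =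
            ν (u, r • ((circlePoint (2 * Real.pi * (s : ℝ)) : 𝕊 1) : 𝔼 2))) ∧
        (∀ t : ↥mappingTorusPieceTwo,
          ((jB (y, t) : ↥K.complement) : 𝕊 3) =
            ν (u, r • ((circlePoint (2 * Real.pi * (t : ℝ)) : 𝕊 1) : 𝔼 2))))

/-- **Probe 1: the capped monodromy is the identity on the collar.** For any data satisfying the clauses
of `FibresWithVia K ν F p φ`, the disc chart `d` at `p` satisfies `φ (d (r • u)) = d (r • u)` for
`0 < r < 1`, `u ∈ 𝕊¹`. [folklore] -/
theorem FibresWithVia.phi_eq_self_on_collar {K : Knot} {ν : Knot.TubularNbhd K} {F : Type}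
    [TopologicalSpace F] [T2Space F] [ChartedSpace (𝔼 2) F] {p : F} {φ : F ≃ₘ⟮𝓡 2, 𝓡 2⟯ F}
    (h : FibresWithVia K ν F p φ) :
    ∃ d : (𝔼 2) → F, Manifold.IsSmoothEmbedding (𝓡 2) (𝓡 2) ∞ d ∧ IsOpen (range d) ∧ d 0 = p ∧
      ∀ (u : 𝕊 1) (r : ℝ), r ∈ Ioo (0 : ℝ) 1 →
        φ (d (r • ((u : 𝕊 1) : 𝔼 2))) = d (r • ((u : 𝕊 1) : 𝔼 2)) := by
  obtain ⟨θ, jA, jB, d, hθ, ⟨hA, hAo, hB, hBo, hU, hR⟩, hd, hdo, hd0, hcl⟩ := h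
  refine ⟨d, hd, hdo, hd0, fun u r hr => ?_⟩
  -- the collar point as a point of the punctured surface
  have hne : d (r • ((u : 𝕊 1) : 𝔼 2)) ≠ p := by
    intro hp
    have hinj : Injective d := hd.isEmbedding.injective
    have : r • ((u : 𝕊 1) : 𝔼 2) = 0 := hinj (hp.trans hd0.symm)
    exact smul_ne_zero hr.1.ne' (ne_zero_of_mem_unit_sphere u) this
  set y : ↥(puncture F p) := ⟨d (r • ((u : 𝕊 1) : 𝔼 2)), hne⟩ with hy
  obtain ⟨hJA, hJB⟩ := hcl y u r hr rfl
  -- the two cylinder points `(y, 1/4)` and `(y, 5/4)` land on the same point of `S³ ∖ K`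
  let s₀ : ↥mappingTorusPieceOne := ⟨1 / 4, by
    change (1 / 4 : ℝ) ∈ Ioo (0 : ℝ) 1
    constructor <;> norm_num⟩
  let t₀ : ↥mappingTorusPieceTwo := ⟨5 / 4, by
    change (5 / 4 : ℝ) ∈ Ioo (1 / 2 : ℝ) (3 / 2)
    constructor <;> norm_num⟩
  have hper : circlePoint (2 * Real.pi * ((t₀ : ℝ))) = circlePoint (2 * Real.pi * ((s₀ : ℝ))) := by
    have : (2 * Real.pi * ((t₀ : ℝ))) = 2 * Real.pi * ((s₀ : ℝ)) + 2 * Real.pi := by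
      show 2 * Real.pi * (5 / 4 : ℝ) = 2 * Real.pi * (1 / 4 : ℝ) + 2 * Real.pi
      ring
    rw [this, circlePoint_add_two_pi]
  have heq : jA (y, s₀) = jB (y, t₀) := by
    apply Subtype.ext
    rw [hJA s₀, hJB t₀, hper]
  -- hence the gluing relation holds, and only its monodromy clause is possible
  have hrel : mappingTorusRel ⇑θ (y, s₀) (y, t₀) := (hR _ _).1 heq
  rcases hrel with ⟨hts, -⟩ | ⟨-, hyθ⟩
  · exfalso
    have : (5 / 4 : ℝ) = 1 / 4 := hts
    norm_num at this
  · -- `y = θ y`, so `φ y = y`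
    have h1 : ((θ y : ↥(puncture F p)) : F) = φ (y : F) := hθ y
    have h2 : (y : F) = d (r • ((u : 𝕊 1) : 𝔼 2)) := rfl
    rw [← h2, ← h1, ← hyθ]

end Summit.SmoothPoincare4.SmoothPoincare4.Cruxes.ZseCruxRasmussen.MonodromyKernelEngine.Drefute

end
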